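/-
Origin: expansion seat `planner-pub-hodgecm-mc-sanity-1-0`, handover #4 2026-08-18T19:05Z md5 0d709a436a147443f14685637cb11456 (NEW additive leaf, 109 l.; imports HodgeCM.Model.Sanity.OffRegimeRank (row 3) only) (`HOME/mc/pub-hodgecm-mc-sanity-1/lean/OffRegimeRankHR.lean`, md5 0d709a43, 109 lines);
landed by the packager successor (mc-unitary-1-g3, gen-8 kit) in gate run 32 as `HodgeCM/Model/Sanity/OffRegimeRankHR.lean` (verbatim).
-/
/-
HodgeCM / MODEL-CONSTRUCTION sub-cell (pub-hodgecm), node SAN — construction prover `pub-hodgecm-mc-sanity-1`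
(seat planner-pub-hodgecm-mc-sanity-1-0), 2026-08-18.  Intended PKG path: `HodgeCM/Model/Sanity/OffRegimeRankHR.lean`.
Imports `Sanity/OffRegimeRank.lean` (this seat) only; nothing restated, no new axioms, no hypotheses records, 0 proof holes.
-/
import Summits.HodgeConjecture.HodgeCM.Model.Sanity.OffRegimeRank

/-!
# Sanity: C2 + Hodge–Riemann (2,0) off the anisotropic regime ⇒ `dim F²H²(pms) ≤ 1` (`= 0` where `emb = 0`)

Sharpening of `OffRegimeRank.lean` by the outer argument `hHR : U.Fact_hodgeRiemann20` of E2's consumer (a nonzero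
`F²`-class of a surface has nonzero Petersson self-trace) — addressed to the G0 ruling J-SAN ("off-regime
`pms := pms c₀`") and to E-J's planned `emb Γ := if IsAnisotropic … then transportEmb … else 0`:

* `F2_eq_zero_of_innerEmb_of_emb_eq_zero` (ANY context, any regime): if `emb Γ = 0` then C2 at `Γ` together with
  HR(2,0) and `dim (pms Γ) = 2` force `F²H²(pms L ι₁ V Γ) = 0`.  So "`else 0`" for `emb` discharges C2 off-regime
  ONLY IF the off-regime period surface has NO nonzero `F²`-class (`h^{2,0} = 0` in the coded Hodge structure).
* `F2_rank_le_one_of_innerEmb` (off-regime, ANY `emb`): C2 + HR(2,0) + `dim = 2` at a context with `V.Hm` not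
  anisotropic ⇒ any two `F²`-classes of `pms L ι₁ V Γ` are linearly dependent (`h^{2,0} ≤ 1`).  Proof: the Gram
  identity of `OffRegimeRank.petersson_gram_eq_of_innerEmb` plus HR: for `η₁ ≠ 0` put `t := P(η₂,η₁)/P(η₁,η₁)`,
  `ξ := η₂ - t•η₁`; then `P(ξ,η₁) = 0` by the choice of `t` (linearity in the first slot only — no hermitian
  symmetry of the Petersson form is used) and `P(ξ,ξ) = P(ξ,η₂) = (P₁₁P₂₂ - P₁₂P₂₁)/P₁₁ = 0`, so `ξ = 0` by HR.

Consequence for J-SAN as ruled (18:50:09Z): with `pms L ι₁ V Γ := pms c₀` (a fixed IN-regime Picard code) at every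
off-regime `(L, ι₁, V)`, an E2 witness over the G0 universe (which proves `hHR` and `pms_dim`) requires
`h^{2,0}(S_{c₀}) ≤ 1`, and `= 0` if `emb := 0` there — for EVERY choice of the other fields.
-/

set_option autoImplicit false

noncomputable section

open HodgeCM HodgeCM.Universe
open scoped InnerProductSpace
open Literature.AlgebraicGeometry.Motives (HodgeStructure)
open Literature.AlgebraicGeometry.Motives.HodgeStructure (conj conj_smul)

attribute [-instance] Quotient.instMeasurableSpace

namespace HodgeCM

namespace Universe.AdelicThetaCore

variable {U : Universe} {hP : PrintFact_unitaryCompact} {C : U.AdelicThetaCore hP} (h : Bool)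
variable (d12 d34 : ∀ {L : CMField}, SeesawCtx L → SideData L)

/-- **`emb Γ = 0` + C2 + HR(2,0) ⇒ `F²H²(pms Γ) = 0`** (any context, any regime). -/
theorem F2_eq_zero_of_innerEmb_of_emb_eq_zero (hHR : U.Fact_hodgeRiemann20)
    (hC2 : (C.thetaModel h d12 d34).Fact_innerEmb) {L : CMField} {ι₁ : L →+* ℂ} {V : HermSpace3 L ι₁}
    (Γ : Level V) (hdim : U.dim (U.pms L ι₁ V Γ) = 2) (h0 : C.emb Γ = 0) (η : U.CohC (U.pms L ι₁ V Γ) 2)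
    (hη : η ∈ (U.hodge (U.pms L ι₁ V Γ) 2).F 2) : η = 0 := by
  rw [C.thetaModel_innerEmb_iff h d12 d34] at hC2
  obtain ⟨a, ha, H⟩ := hC2 Γ
  by_contra hne
  have h1 := H η η hη hη
  rw [h0, LinearMap.zero_apply, inner_zero_left] at h1
  rcases mul_eq_zero.mp h1.symm with h2 | h2
  · exact ha h2
  · exact hHR _ hdim η hη hne h2

/-- Hence: if `emb` vanishes at some context carrying a nonzero `F²`-class of a surface, C2 FAILS (given HR(2,0)). -/
theorem not_innerEmb_of_emb_eq_zero (hHR : U.Fact_hodgeRiemann20) {L : CMField} {ι₁ : L →+* ℂ}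
    {V : HermSpace3 L ι₁} (Γ : Level V) (hdim : U.dim (U.pms L ι₁ V Γ) = 2) (h0 : C.emb Γ = 0)
    (η : U.CohC (U.pms L ι₁ V Γ) 2) (hη : η ∈ (U.hodge (U.pms L ι₁ V Γ) 2).F 2) (hne : η ≠ 0) :
    ¬ (C.thetaModel h d12 d34).Fact_innerEmb :=
  fun hC2 => hne (F2_eq_zero_of_innerEmb_of_emb_eq_zero h d12 d34 hHR hC2 Γ hdim h0 η hη)

/-- **C2 + HR(2,0) off the anisotropic regime ⇒ `h^{2,0}(pms) ≤ 1`**: any two `F²`-classes are dependent. -/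
theorem F2_rank_le_one_of_innerEmb (hHR : U.Fact_hodgeRiemann20) (hC2 : (C.thetaModel h d12 d34).Fact_innerEmb)
    {L : CMField} {ι₁ : L →+* ℂ} (V : HermSpace3 L ι₁) (hV : ¬ IsAnisotropic L V.Hm) (Γ : Level V)
    (hdim : U.dim (U.pms L ι₁ V Γ) = 2) (η₁ η₂ : U.CohC (U.pms L ι₁ V Γ) 2)
    (h₁ : η₁ ∈ (U.hodge (U.pms L ι₁ V Γ) 2).F 2) (h₂ : η₂ ∈ (U.hodge (U.pms L ι₁ V Γ) 2).F 2) (hne : η₁ ≠ 0) :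
    ∃ t : ℂ, η₂ = t • η₁ := by
  -- the Petersson form of the context
  let P : U.CohC (U.pms L ι₁ V Γ) 2 → U.CohC (U.pms L ι₁ V Γ) 2 → ℂ := fun η η' =>
    U.trC (U.pms L ι₁ V Γ) 4 (U.cup2C (U.pms L ι₁ V Γ) 2 η (conj η'))
  have hPdef : ∀ η η', P η η' = U.trC (U.pms L ι₁ V Γ) 4 (U.cup2C (U.pms L ι₁ V Γ) 2 η (conj η')) :=
    fun _ _ => rfl
  have gram : P η₁ η₁ * P η₂ η₂ = P η₁ η₂ * P η₂ η₁ :=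
    petersson_gram_eq_of_innerEmb h d12 d34 hC2 V hV Γ η₁ η₂ h₁ h₂
  have hP11 : P η₁ η₁ ≠ 0 := hHR _ hdim η₁ h₁ hne
  -- linearity in the first slot, antilinearity in the second
  have hsub₁ : ∀ η η' ζ, P (η - η') ζ = P η ζ - P η' ζ := fun η η' ζ => by
    simp only [hPdef, map_sub, LinearMap.sub_apply]
  have hsmul₁ : ∀ (t : ℂ) η ζ, P (t • η) ζ = t * P η ζ := fun t η ζ => by
    simp only [hPdef, map_smul, LinearMap.smul_apply, smul_eq_mul]
  have hsub₂ : ∀ η ζ ζ', P η (ζ - ζ') = P η ζ - P η ζ' := fun η ζ ζ' => by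
    simp only [hPdef, map_sub]
  have hsmul₂ : ∀ (t : ℂ) η ζ, P η (t • ζ) = starRingEnd ℂ t * P η ζ := fun t η ζ => by
    simp only [hPdef, conj_smul, map_smul, smul_eq_mul]
  refine ⟨P η₂ η₁ / P η₁ η₁, ?_⟩
  -- ξ := η₂ - t • η₁ is Petersson-orthogonal to η₁ and has zero self-trace
  have hξ₁ : P (η₂ - (P η₂ η₁ / P η₁ η₁) • η₁) η₁ = 0 := by
    rw [hsub₁, hsmul₁, div_mul_cancel₀ _ hP11, sub_self]
  have hξ₂ : P (η₂ - (P η₂ η₁ / P η₁ η₁) • η₁) η₂ = 0 := by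
    rw [hsub₁, hsmul₁, div_mul_eq_mul_div, sub_eq_zero, eq_div_iff hP11]
    linear_combination gram
  have hξξ : P (η₂ - (P η₂ η₁ / P η₁ η₁) • η₁) (η₂ - (P η₂ η₁ / P η₁ η₁) • η₁) = 0 := by
    rw [hsub₂, hsmul₂, hξ₁, hξ₂, mul_zero, sub_zero]
  have hξmem : η₂ - (P η₂ η₁ / P η₁ η₁) • η₁ ∈ (U.hodge (U.pms L ι₁ V Γ) 2).F 2 :=
    Submodule.sub_mem _ h₂ (Submodule.smul_mem _ _ h₁)
  by_contra hne₂
  exact hHR _ hdim _ hξmem (fun h0 => hne₂ (sub_eq_zero.mp h0)) hξξ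

end Universe.AdelicThetaCore

end HodgeCM

end
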